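import Mathlib
import Summits.BirchSwinnertonDyer.BirchSwinnertonDyer.Theorems.ManinLocalTwoThreeTwoDvdModularDegreeOfAtkinLehnerInvariant
import Literature.NumberTheory.EllipticCurves.BSDHeegnerPointsTorsionProofs
import HarnessLib

/-!
# `w_Q f = +f` ⟹ the Atkin–Lehner cusp `w(Q)∞` is a HALF-PERIOD: `2{∞, x/(N/Q)}_f ∈ Λ_f`, `2·t_Q = O`

Summit `BirchSwinnertonDyer`, sub-problem `BirchSwinnertonDyer`, route `ManinLocalTwoThree`; width seat `bsd-line-manin23-p2`
(gen 9), `--supports` the crux C2 `ManinOddAtFour` (stmt-BirchSwinnertonDyer-22967).  Cell `bsd-f2-manin`, an/es cusp-torsion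
bookkeeping (Literature `ModularParametrizationData.atkinLehnerCuspPoint`, known only to be torsion by Manin–Drinfeld,
`isOfFinAddOrder_atkinLehnerCuspPoint`): iterating `E_f(w(Q) z) = ε E_f(z) + {∞, x/(N/Q)}_f` (`eichlerIntegral_atkinLehnerW_smul`)
and using `w(Q)² = γ₀·Q` (`exists_atkinLehnerW_mul_self`), `E_f(γ₀ z) − E_f(z) = ξ(γ₀) ∈ Λ_f` gives
`(1 + ε){∞, x/(N/Q)}_f = ξ(γ₀)`; so for `ε = +1` the cusp symbol is a half-period and `2·t_Q = O` in `E(ℂ)`.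

PROVED here (no `sorry`): **`two_mul_modularSymbol_atkinLehnerCusp_mem_of_eq_self`**, **`two_smul_atkinLehnerCuspPoint_eq_zero`**,
and, with the seat's even-degree theorem, **`two_dvd_modularDegree_or_addOrderOf_eq_two`**: for `w_Q f_D = f_D` (`Q ∥ N`, `Q > 1`)
either `2 ∣ deg φ_D` or `t_Q` has exact order `2`.  BSD is not proved by this; Manin's conjecture is not proved by this.
-/

set_option autoImplicit false
set_option linter.dupNamespace false

noncomputable section

open scoped MatrixGroups ModularForm
open CongruenceSubgroup Matrix.SpecialLinearGroup UpperHalfPlane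
open Literature.NumberTheory.EllipticCurves Literature.NumberTheory.EllipticCurves.ModularForms

namespace Summit.BirchSwinnertonDyer.BirchSwinnertonDyer.Theorems.ManinLocalTwoThree

variable {N Q : ℕ} [NeZero N] [NeZero Q]

/-- **`w_Q f = f ⟹ 2{∞, x/(N/Q)}_f ∈ Λ_f`** (`x/(N/Q) = w(Q)∞`). -/
theorem two_mul_modularSymbol_atkinLehnerCusp_mem_of_eq_self (hQN : Q ∣ N) (hc : Nat.Coprime Q (N / Q))
    {f : CuspForm (Gamma0 N) 2} (hf : atkinLehnerInvolution N 2 Q f = f) :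
    2 * modularSymbol f ((atkinLehnerSL N Q 0 0 : ℚ) / (N / Q : ℕ)) ∈ periodLattice f := by
  have hf' : atkinLehnerInvolution N 2 Q f = (1 : ℂ) • f := by rw [one_smul]; exact hf
  set Wm : GL (Fin 2) ℝ := glCast (atkinLehnerW N Q : GL (Fin 2) ℚ) with hWm
  set m := modularSymbol f ((atkinLehnerSL N Q 0 0 : ℚ) / (N / Q : ℕ)) with hm
  obtain ⟨γ₀, hγ₀, hsq⟩ := exists_atkinLehnerW_mul_self N Q hQN hc
  -- `E(w w z) = E(z) + 2m`
  have h2 : eichlerIntegral f (Wm • Wm • UpperHalfPlane.I) = eichlerIntegral f UpperHalfPlane.I + 2 * m := by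
    rw [eichlerIntegral_atkinLehnerW_smul hQN hc hf', eichlerIntegral_atkinLehnerW_smul hQN hc hf']; ring
  -- `w w z = γ₀ z`
  have hQ : (0 : ℝ) < Q := by exact_mod_cast NeZero.pos Q
  have hscal : (tpD Q * tpG Q : GL (Fin 2) ℝ) • UpperHalfPlane.I = UpperHalfPlane.I := by
    have hdet : 0 < (tpD Q * tpG Q : GL (Fin 2) ℝ).det.val := by
      rw [map_mul, Units.val_mul]
      have h1 : 0 < (tpD Q : GL (Fin 2) ℝ).det.val := by
        rw [Matrix.GeneralLinearGroup.val_det_apply, val_tpD, Matrix.det_fin_two_of]; simp [hQ]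
      have h2' : 0 < (tpG Q : GL (Fin 2) ℝ).det.val := by
        rw [Matrix.GeneralLinearGroup.val_det_apply, val_tpG, Matrix.det_fin_two_of]; simp [hQ]
      exact mul_pos h1 h2'
    have hval : ((tpD Q * tpG Q : GL (Fin 2) ℝ) : Matrix (Fin 2) (Fin 2) ℝ) = !![(Q : ℝ), 0; 0, Q] := by
      rw [Matrix.GeneralLinearGroup.coe_mul, val_tpD, val_tpG]
      ext i j
      fin_cases i <;> fin_cases j <;> simp [Matrix.mul_apply, Fin.sum_univ_two]
    have e10 : (tpD Q * tpG Q : GL (Fin 2) ℝ) 1 0 = 0 := by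
      show ((tpD Q * tpG Q : GL (Fin 2) ℝ) : Matrix (Fin 2) (Fin 2) ℝ) 1 0 = 0; rw [hval]; simp
    have e01 : (tpD Q * tpG Q : GL (Fin 2) ℝ) 0 1 = 0 := by
      show ((tpD Q * tpG Q : GL (Fin 2) ℝ) : Matrix (Fin 2) (Fin 2) ℝ) 0 1 = 0; rw [hval]; simp
    have e00 : (tpD Q * tpG Q : GL (Fin 2) ℝ) 0 0 = (tpD Q * tpG Q : GL (Fin 2) ℝ) 1 1 := by
      show ((tpD Q * tpG Q : GL (Fin 2) ℝ) : Matrix (Fin 2) (Fin 2) ℝ) 0 0 =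
        ((tpD Q * tpG Q : GL (Fin 2) ℝ) : Matrix (Fin 2) (Fin 2) ℝ) 1 1
      rw [hval]; simp
    exact smul_eq_self_of_scalar hdet e10 e01 e00 _
  have hww : Wm • Wm • UpperHalfPlane.I = ((γ₀ : SL(2, ℤ)) • UpperHalfPlane.I : ℍ) := by
    rw [smul_smul, hWm, hsq, mul_smul, hscal]; rfl
  have E2 := eichlerIntegral_smul_sub_holds f ⟨γ₀, hγ₀⟩ UpperHalfPlane.I
  have key : 2 * m = cuspSymbol f ⟨γ₀, hγ₀⟩ := by
    rw [← E2]
    change _ = eichlerIntegral f ((γ₀ : SL(2, ℤ)) • UpperHalfPlane.I) - _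
    rw [← hww, h2]; ring
  rw [key]
  exact cuspSymbol_mem_periodLattice f ⟨γ₀, hγ₀⟩

/-- **`w_Q f_D = f_D ⟹ 2·t_Q = O`** for the Atkin–Lehner cusp point `t_Q = φ_D(w(Q)∞)`. -/
theorem two_smul_atkinLehnerCuspPoint_eq_zero (hQN : Q ∣ N) (hc : Nat.Coprime Q (N / Q)) {W : WeierstrassCurve ℚ}
    [W.IsElliptic] (D : ModularParametrizationData W N) (hf : atkinLehnerInvolution N 2 Q D.f = D.f) :
    2 • D.atkinLehnerCuspPoint Q = 0 := by
  have h := two_mul_modularSymbol_atkinLehnerCusp_mem_of_eq_self hQN hc hf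
  rw [ModularParametrizationData.atkinLehnerCuspPoint, ← map_nsmul, nsmul_eq_mul, Nat.cast_ofNat,
    show (2 : ℂ) * ((D.c : ℂ) * modularSymbol D.f ((atkinLehnerSL N Q 0 0 : ℚ) / (N / Q : ℕ))) =
      (D.c : ℂ) * (2 * modularSymbol D.f ((atkinLehnerSL N Q 0 0 : ℚ) / (N / Q : ℕ))) by ring]
  exact (D.uniformize_eq_zero_iff _).mpr (D.smul_periodLattice_le _ h)

/-- **Dichotomy for `w_Q f_D = f_D`** (`Q ∥ N`, `Q > 1`): either `2 ∣ deg φ_D`, or the cusp point `t_Q = φ_D(w(Q)∞)` has EXACT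
order `2` in `E(ℂ)`. -/
theorem two_dvd_modularDegree_or_addOrderOf_eq_two (hQN : Q ∣ N) (hc : Nat.Coprime Q (N / Q)) (hQ1 : Q ≠ 1)
    {W : WeierstrassCurve ℚ} [W.IsElliptic] (D : ModularParametrizationData W N)
    (hf : atkinLehnerInvolution N 2 Q D.f = D.f) :
    2 ∣ D.modularDegree ∨ addOrderOf (D.atkinLehnerCuspPoint Q) = 2 := by
  by_cases h0 : D.atkinLehnerCuspPoint Q = 0
  · exact Or.inl (two_dvd_modularDegree_of_atkinLehnerW_invariant hQN hc hQ1 D hf h0)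
  · haveI : Fact (Nat.Prime 2) := ⟨Nat.prime_two⟩
    exact Or.inr (addOrderOf_eq_prime (two_smul_atkinLehnerCuspPoint_eq_zero hQN hc D hf) h0)

end Summit.BirchSwinnertonDyer.BirchSwinnertonDyer.Theorems.ManinLocalTwoThree

end
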